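import Literature.AlgebraicGeometry.Frobenioids.BaseCategoryTheoreticityDefs
import HarnessLib

/-!
# Frobenioids I, Proposition 3.3 (iii), (iv): the unit-trivialisation `C^istr → C^un-tr` — PROOFS

Mochizuki, *The geometry of Frobenioids I: the general theory*, Kyushu J. Math. **62** (2008),
kurims text pp. 59–61 [cite: MochizukiFrdI2008, Prop. 3.3 (iii)(iv) pp.59-61]. Proof-only
companion of `BaseCategoryTheoreticityDefs.lean` (seat abc-iut-L1-t3), which TYPES Prop. 3.3 as
conclusion predicates `Prop33iii S`, `Prop33iv S`, `Prop33ii S` over the operations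
`S : PreFrobenioidData C D`; discharged here AS TYPED (abc-iut cell node ids `FrdI:Prop3.3(iii)`,
`FrdI:Prop3.3(iv)`; the paper, p. 61: "assertion (iii) is immediate from the definitions. In light of
assertions (ii), (iii), assertion (iv) is immediate from the definitions").

* `prop33iii_holds S : Prop33iii S` — for EVERY `S` (no Frobenioid hypothesis is needed as typed):
  the quotient functor `C^istr → C^un-tr` is an equivalence iff every isotropic object is
  unit-trivial. (`⇒`: for a unit `δ ∈ O^×(A)` of an isotropic `A`, `id ≈^{O^×} δ`, so faithfulness
  forces `δ = 1`; `⇐`: unit-equivalent arrows are then equal, so the generating relation, its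
  composition closure and the generated equivalence relation are all contained in equality.)
* `prop33iv_of_prop33ii S : Prop33ii S → Prop33iv S` — (iv) as typed is a formal consequence of
  (ii) as typed (first clause = necessity in (ii); second clause = sufficiency in (ii) followed by
  `Quotient.sound`). The named fact `Prop33ii` for Frobenioids is discharged separately (seat
  abc-iut-L1-t13); the unconditional half of (iv) — unit-equivalent arrows have the same
  `deg_Fr` and `Base` — is also proved here directly (`UnitEquiv.degFr_eq`, `UnitEquiv.base_eq`).
No new definitions; nothing here is specific to the abc programme.
-/

namespace Literature.AlgebraicGeometry.Frobenioids

open CategoryTheory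

universe w v v' u u'

variable {C : Type u} [Category.{v} C] {D : Type u'} [Category.{v'} D]
variable (S : PreFrobenioidData.{w} C D)

namespace PreFrobenioidData

/-! ### Unit-equivalence: elementary consequences of Definition 3.1 (iv) -/

/-- `id_A ≈^{O^×} δ` for every unit `δ ∈ O^×(A)` of an isotropic object `A` (take `γ = β = id`
in Def. 3.1 (iv)). [cite: MochizukiFrdI2008, Def. 3.1 (iv) p.57] -/
theorem UnitEquiv.id_unit (X : S.Istr) (δ : Aut X.obj) (hδ : δ ∈ S.unitsSubgroup X.obj) :
    S.UnitEquiv (𝟙 X) (ObjectProperty.homMk δ.hom) :=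
  ⟨X, 𝟙 X, 𝟙 X, δ, hδ, (Category.comp_id _).symm, by rw [Category.comp_id, Category.id_comp]⟩

/-- If every isotropic object is unit-trivial, unit-equivalent arrows of `C^istr` are equal
(the bracketed remark of Def. 3.1 (iv), p. 57, needs unit-triviality only on `C^istr`).
[cite: MochizukiFrdI2008, Def. 3.1 (iv) p.57] -/
theorem UnitEquiv.eq_of_isUnitTrivial_istr (h : ∀ A : C, S.IsIsotropic A → S.IsUnitTrivial A)
    {A B : S.Istr} {α₁ α₂ : A ⟶ B} (e : S.UnitEquiv α₁ α₂) : α₁ = α₂ := by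
  obtain ⟨X, γ, β, δ, hδ, rfl, rfl⟩ := e
  have hX : S.unitsSubgroup X.obj = ⊥ := h X.obj X.property
  have hδ1 : δ = 1 := by
    rw [hX] at hδ
    exact hδ
  subst hδ1
  have : (ObjectProperty.homMk (1 : Aut X.obj).hom : X ⟶ X) = 𝟙 X := rfl
  rw [this, Category.id_comp]

/-- Unit-equivalent arrows have the same Frobenius degree (necessity of (a) in Prop. 3.3 (ii); holds
for every `S`). [cite: MochizukiFrdI2008, Prop. 3.3 (ii) p.59] -/
theorem UnitEquiv.degFr_eq {A B : S.Istr} {α₁ α₂ : A ⟶ B} (e : S.UnitEquiv α₁ α₂) :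
    S.degFr α₁.hom = S.degFr α₂.hom := by
  obtain ⟨X, γ, β, δ, hδ, rfl, rfl⟩ := e
  have hlin : S.degFr δ.hom = 1 := hδ.2
  simp only [ObjectProperty.FullSubcategory.comp_hom, ObjectProperty.homMk_hom, S.degFr_comp, hlin,
    one_mul]

/-- Unit-equivalent arrows have the same projection to the base (necessity of (c) in Prop. 3.3 (ii);
holds for every `S`). [cite: MochizukiFrdI2008, Prop. 3.3 (ii) p.59] -/
theorem UnitEquiv.base_eq {A B : S.Istr} {α₁ α₂ : A ⟶ B} (e : S.UnitEquiv α₁ α₂) :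
    S.base.map α₁.hom = S.base.map α₂.hom := by
  obtain ⟨X, γ, β, δ, hδ, rfl, rfl⟩ := e
  have hb : S.base.map δ.hom = 𝟙 _ := hδ.1
  simp only [ObjectProperty.FullSubcategory.comp_hom, ObjectProperty.homMk_hom, Functor.map_comp, hb,
    Category.id_comp]

/-! ### Proposition 3.3 (iii) -/

/-- The relation "unit-equivalent arrows are equal" passes to the composition closure of `≈^{O^×}` and
to the equivalence relation it generates (= the hom-relation of `C^istr → C^un-tr`).
[cite: MochizukiFrdI2008, Prop. 3.3 (iii) p.60] -/
theorem eq_of_eqvGen_compClosure_unitEquiv (h : ∀ A : C, S.IsIsotropic A → S.IsUnitTrivial A)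
    {A B : S.Istr} {α₁ α₂ : A ⟶ B}
    (hrel : Relation.EqvGen (@HomRel.CompClosure S.Istr _ S.UnitEquiv A B) α₁ α₂) : α₁ = α₂ := by
  -- the composition closure of `≈^{O^×}` is contained in equality
  have hcc : ∀ {A B : S.Istr} (f g : A ⟶ B), HomRel.CompClosure S.UnitEquiv f g → f = g := by
    rintro A B f g ⟨a, b, f', m₁, m₂, g', hm⟩
    rw [UnitEquiv.eq_of_isUnitTrivial_istr S h hm]
  induction hrel with
  | rel x y hxy => exact hcc x y hxy
  | refl x => rfl
  | symm x y _ ih => exact ih.symm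
  | trans x y z _ _ ih₁ ih₂ => exact ih₁.trans ih₂

/-- If `C^istr` is of unit-trivial type, the quotient functor `C^istr → C^un-tr` is injective on arrows.
[cite: MochizukiFrdI2008, Prop. 3.3 (iii) p.60] -/
theorem toUntr_map_injective_of_isUnitTrivial_istr
    (h : ∀ A : C, S.IsIsotropic A → S.IsUnitTrivial A) {A B : S.Istr} {α₁ α₂ : A ⟶ B}
    (e : S.toUntr.map α₁ = S.toUntr.map α₂) : α₁ = α₂ :=
  eq_of_eqvGen_compClosure_unitEquiv S h
    ((CategoryTheory.Quotient.functor_homRel_eq_compClosure_eqvGen S.UnitEquiv α₁ α₂).mp e)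

/-- **Proposition 3.3 (iii)** [FrdI p. 60], AS TYPED in `BaseCategoryTheoreticityDefs.lean` and for every
`S : PreFrobenioidData C D`: the (full, essentially surjective) functor `C^istr → C^un-tr` is an
equivalence of categories iff `C^istr` is of unit-trivial type. Discharges node `FrdI:Prop3.3(iii)`.
[cite: MochizukiFrdI2008, Prop. 3.3 (iii) p.60] -/
theorem prop33iii_holds : Prop33iii S := by
  constructor
  · intro hE A hA
    -- `C^istr → C^un-tr` faithful: a unit `δ` of the isotropic `A` satisfies `[id] = [δ]`, so `δ = 1`
    haveI := hE.faithful
    rw [PreFrobenioidData.IsUnitTrivial, Subgroup.eq_bot_iff_forall]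
    intro δ hδ
    let X : S.Istr := ⟨A, hA⟩
    have h1 : S.toUntr.map (𝟙 X) = S.toUntr.map (ObjectProperty.homMk δ.hom) :=
      CategoryTheory.Quotient.sound S.UnitEquiv (UnitEquiv.id_unit S X δ hδ)
    have h2 : (𝟙 X : X ⟶ X) = ObjectProperty.homMk δ.hom := S.toUntr.map_injective h1
    have h3 : δ.hom = 𝟙 A := by
      have := congrArg InducedCategory.Hom.hom h2
      simpa using this.symm
    ext
    exact h3
  · intro h
    haveI : S.toUntr.Faithful := ⟨fun e => toUntr_map_injective_of_isUnitTrivial_istr S h e⟩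
    exact {  }

/-- `Prop33iii` — `_holds` alias of `prop33iii_holds` above under the fact's exact name (appended
2026-08-28, D-0026 bookkeeping: the proof term is the existing theorem of this file; no statement,
definition or attribute is edited; no new named fact; the ledger's debt table listed the fact
unproved). [cite: MochizukiFrdI2008, Prop. 3.3 (iii) p.60] -/
theorem _root_.Literature.AlgebraicGeometry.Frobenioids.Prop33iii_holds : Prop33iii S :=
  _root_.Literature.AlgebraicGeometry.Frobenioids.PreFrobenioidData.prop33iii_holds (S := S)

/-! ### Proposition 3.3 (iv) from Proposition 3.3 (ii) -/

/-- **Proposition 3.3 (iv)** [FrdI p. 60], AS TYPED, follows formally from **Proposition 3.3 (ii)** AS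
TYPED (for every `S`): unit-equivalent arrows have the same `(deg_Fr, Div, Base)` — so `C^istr → F_Φ`
factors through `C^un-tr` — and arrows with the same three invariants are unit-equivalent, hence are
identified in `C^un-tr` — so `C^un-tr → F_Φ` is faithful ("In light of assertions (ii), (iii),
assertion (iv) is immediate from the definitions", p. 61). With the named fact `Prop33ii` for
Frobenioids (seat abc-iut-L1-t13) this discharges node `FrdI:Prop3.3(iv)`.
[cite: MochizukiFrdI2008, Prop. 3.3 (iv) p.60] -/
theorem prop33iv_of_prop33ii (h : Prop33ii S) : Prop33iv S := by
  refine ⟨fun A B α₁ α₂ e => (h α₁ α₂).mp e, fun A B α₁ α₂ ha hb hc => ?_⟩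
  exact CategoryTheory.Quotient.sound S.UnitEquiv ((h α₁ α₂).mpr ⟨ha, hb, hc⟩)

/-- The first clause of **Proposition 3.3 (iv)** for the invariants `deg_Fr` and `Base`, unconditionally
(every `S`): `C^istr → D` and `deg_Fr` factor through `C^un-tr`. (The `Div`-clause needs "units are
isometries", i.e. the Frobenioid axioms, and is part of `Prop33ii`.) [cite: MochizukiFrdI2008, Prop. 3.3 (iv) p.60] -/
theorem unitEquiv_degFr_base {A B : S.Istr} (α₁ α₂ : A ⟶ B) (e : S.UnitEquiv α₁ α₂) :
    S.degFr α₁.hom = S.degFr α₂.hom ∧ S.base.map α₁.hom = S.base.map α₂.hom :=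
  ⟨UnitEquiv.degFr_eq S e, UnitEquiv.base_eq S e⟩

end PreFrobenioidData

end Literature.AlgebraicGeometry.Frobenioids
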